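import Literature.MathematicalPhysics.QuantumFieldTheory.Balaban1983to89.Beta.BalabanCompositeJets

/-!
# `BalabanUV.Beta.GAN24.PushSumNest` — binder row G-an2-4 / (CONV-C), S-slot remainder «E3Shape»: the POSITION-SPACE half of
# node S3-L3(c)/(d) of `HOME/b2b-balaban-gan24-p1/SKELETON-S3.md` v0.2 (typer DAG § II.6 prospective R6/R7) — ENGINE «PUSH-NEST*»

NOT IN PRINT; OUR PROOF ATTEMPT.  HONEST FRAMING (cell contract, verbatim): «discharging `BetaPertH` makes Bałaban's UV stability
UNCONDITIONAL — a real constructive-QFT result; it is NOT the continuum limit and NOT the Clay problem.»  HONEST DEPENDENCY (verbatim):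
«continuum YM on T⁴ ⇐ BetaPertH ∧ nine spine estimates (0/9 proved); BetaPertH ⇐ (D1) ∧ (D4) ∧ CAP+tail; G-an2-4 gates asym, D1 and
NE2/3/4.»  [folklore] finite-sum algebra of an2's TYPED one-step push `BalabanCompositeJets.pushSum` and of the DEFINED composite
stencil recursion `BalabanCompositeJets.Sc` / `Sc_succ` — BY NAME, nothing redefined; NO estimate, NO cited fact, NO `def … : Prop`
hypothesis, NO wall binder, nothing asserted of Bałaban's objects.  Engine «PUSH-NEST*» of unit `b2b-balaban-gan24-formalise-leaf-17` (gen 9),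
filed under this name by the row owner's ruling (gan24-p1-g3, cell journal RULINGS-2: «S3-L3(c)(d)'s algebra of record and D-S3-2's term
list»); the reserved family `GAN24.StencilSlotE3*` is untouched.  NOT summit progress; nothing of (CONV-C)'s S-slot is discharged here.

## What is proved
* §1 LINEARITY of the push in the kernel: `pushSum_add`, `pushSum_smul`, `pushSum_zero`, `pushSum_neg`, `pushSum_sub`,
  `pushSum_finset_sum`.
* §2 NESTING («`Q′_{L₂} ∘ Q′_{L₁} = Q′_{L₁L₂}`» for the UNNORMALISED pushes of the multiplier legs, the `pushSum` avatar of
  `ResolventComposition.contourSum_mul` / [Balaban1984PropagatorsI (1.16)–(1.17)], named in `pushSum`'s docstring but not stated in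
  the tree): **`pushSum_pushSum : pushSum (M·L₁) L₂ (pushSum M L₁ K) = pushSum M (L₁·L₂) K`** for ALL legs and all `K`
  (`M, L₁ ≠ 0`; no support hypothesis — the outer indicator equals the combined one and the inner indicator is identically `1` at
  pushed points).  Mechanism: the bijection `LegIdx d L₂ × LegIdx d L₁ ≃ LegIdx d (L₁L₂)`, `((r₂,s₂),(r₁,s₁)) ↦ (L₁r₂+r₁, L₁s₂+s₁)`
  (`sum_LegIdx_mul`), and `legPt L₁ μ (legPt L₂ μ z i₂) i₁ = legPt (L₁L₂) μ z (comb L₁ i₂ i₁)` (`legPt_legPt`).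
* §3 THE CLOSED FORM of a push recursion `T (n+1) = c • pushSum (Lc^{n+1}) Lc (T n) + I n` (`closed_form_of_rec`):
  `T (n+1) = c^{n+1} • pushSum Lc (Lc^{n+1}) (T 0) + I n + Σ_{m<n} c^{n−m} • pushSum (Lc^{m+2}) (Lc^{n−m}) (I m)` — and its
  instance for an2's composite stencil family (`Sc_succ_closed`): `Sc (n+1) κ u` = the pushed first-step stencil `S₀ κ u` + the top
  increment + the `n` pushed lower increments (border `borderInc` and Lagrange `lagrInc` pieces with their DEFINED unit weights), i.e.
  S3-L3(d)'s «`𝒱_n = Σ_{m<n} push_{m→n}[increment_m] + push_{0→n}[S₀]`» IN POSITION SPACE, before any symbol is taken; the `n+2`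
  pieces are exactly the profile that diagnostic D-S3-2 of SKELETON-S3 §6 measures.
* §4 DICTIONARY `pushSum ↔ AffineAveraging.contourSum` at the points of the new coarse lattice (`pushSum_inr_inl_coarse`,
  `pushSum_inl_inr_coarse`, `pushSum_inr_inr_coarse`): a pushed multiplier leg IS the straight-contour block sum `contourSum L` of the
  `M`-lattice reading `y ↦ K (M•y) …`, so that road P1's `FibreSymbols.contourSum_plane` / `gsum` and road P4's
  `MonotoneCompose.gs_mul` give the alias-frame symbol of a push BY NAME (nothing on the symbol side is minted here).
No analysis.  Prospective consumers: the S3-L3(d) closed form of the vertex bi-symbol, D-S3-2's term list, S3-L8's two-level comparison.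
-/

noncomputable section

open Finset
open scoped BigOperators
open Literature.MathematicalPhysics.QuantumFieldTheory
open Literature.MathematicalPhysics.QuantumFieldTheory.Balaban1983to89
open Literature.MathematicalPhysics.QuantumFieldTheory.Balaban1983to89.Beta
open Literature.Probability.LatticeModels (Torus.proj)
open LatticeForm (quo)
open AffineAveraging (toSite unitVec contourSum Form1)
open OneStepResolventKernel (Fib proj_zsmul quo_zsmul)
open OneStepKernelFamily (legSet legPt legPt_add LegIdx)
open StepDriftWitness (sum_LegIdx_eq_contourSum legPt_inl_eq)
open BalabanStepJets (S0)
open BalabanCompositeJets (pushSet pushPt pushInd pushSum pushSum_inl_inl borderInc lagrInc Sc Sc_zero Sc_succ)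

namespace Summit.QuantumFields.BalabanUV.Beta.GAN24.PushSumNest

variable {d : ℕ}

/-! ## §1 Linearity of the push in the kernel -/

section Linear

variable (M L : ℕ)

/-- [folklore] The push is additive in the kernel. -/
theorem pushSum_add (K K' : ExpKernelCalculus.MKer (d + 1) (Fib d)) :
    pushSum M L (K + K') = pushSum M L K + pushSum M L K' := by
  funext x w a b
  simp only [pushSum, Pi.add_apply, Finset.sum_add_distrib, mul_add]

/-- [folklore] The push commutes with real scalars. -/
theorem pushSum_smul (c : ℝ) (K : ExpKernelCalculus.MKer (d + 1) (Fib d)) :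
    pushSum M L (c • K) = c • pushSum M L K := by
  funext x w a b
  simp only [pushSum, Pi.smul_apply, smul_eq_mul, Finset.mul_sum]
  exact Finset.sum_congr rfl fun _ _ => Finset.sum_congr rfl fun _ _ => by ring

/-- [folklore] The push of the zero kernel vanishes. -/
theorem pushSum_zero : pushSum M L (0 : ExpKernelCalculus.MKer (d + 1) (Fib d)) = 0 := by
  funext x w a b
  simp only [pushSum, Pi.zero_apply, Finset.sum_const_zero, mul_zero]

/-- [folklore] The push commutes with negation. -/
theorem pushSum_neg (K : ExpKernelCalculus.MKer (d + 1) (Fib d)) : pushSum M L (-K) = -pushSum M L K := by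
  rw [← neg_one_smul ℝ K, pushSum_smul, neg_one_smul]

/-- [folklore] The push commutes with differences. -/
theorem pushSum_sub (K K' : ExpKernelCalculus.MKer (d + 1) (Fib d)) :
    pushSum M L (K - K') = pushSum M L K - pushSum M L K' := by
  rw [sub_eq_add_neg, pushSum_add, pushSum_neg, ← sub_eq_add_neg]

/-- [folklore] The push commutes with finite sums. -/
theorem pushSum_finset_sum {ι : Type*} (s : Finset ι) (K : ι → ExpKernelCalculus.MKer (d + 1) (Fib d)) :
    pushSum M L (∑ i ∈ s, K i) = ∑ i ∈ s, pushSum M L (K i) := by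
  classical
  induction s using Finset.induction_on with
  | empty => simp only [Finset.sum_empty, pushSum_zero]
  | insert _ _ hi ih => rw [Finset.sum_insert hi, Finset.sum_insert hi, pushSum_add, ih]

end Linear

/-! ## §2 Nesting of pushes: `Q′_{L₂} ∘ Q′_{L₁} = Q′_{L₁L₂}` -/

section Nest

/-- [folklore] Membership in the field-leg index set: all box coordinates and the contour step are `< M`. -/
theorem mem_LegIdx_iff {M : ℕ} {i : (Fin (d + 1) → ℕ) × ℕ} : i ∈ LegIdx d M ↔ (∀ j, i.1 j < M) ∧ i.2 < M := by
  simp only [LegIdx, Finset.mem_product, Fintype.mem_piFinset, Finset.mem_range]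

/-- [folklore] The COMBINED index of two nested pushes (inner factor `L₁`): `(r₂,s₂),(r₁,s₁) ↦ (L₁r₂ + r₁, L₁s₂ + s₁)`. -/
def comb (L₁ : ℕ) (i₂ i₁ : (Fin (d + 1) → ℕ) × ℕ) : (Fin (d + 1) → ℕ) × ℕ :=
  (fun j => L₁ * i₂.1 j + i₁.1 j, L₁ * i₂.2 + i₁.2)

/-- [folklore] The inverse map: coordinatewise quotient and remainder by `L₁`. -/
def split (L₁ : ℕ) (i : (Fin (d + 1) → ℕ) × ℕ) : ((Fin (d + 1) → ℕ) × ℕ) × ((Fin (d + 1) → ℕ) × ℕ) :=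
  ((fun j => i.1 j / L₁, i.2 / L₁), (fun j => i.1 j % L₁, i.2 % L₁))

/-- [folklore] `L₁·a + b < L₁·L₂` for `a < L₂`, `b < L₁`. -/
theorem mul_add_lt_mul {L₁ L₂ a b : ℕ} (ha : a < L₂) (hb : b < L₁) : L₁ * a + b < L₁ * L₂ :=
  calc L₁ * a + b < L₁ * a + L₁ := Nat.add_lt_add_left hb _
    _ = L₁ * (a + 1) := by ring
    _ ≤ L₁ * L₂ := Nat.mul_le_mul_left _ ha

/-- [folklore] The combined index of two admissible indices is admissible for the product factor. -/
theorem comb_mem {L₁ L₂ : ℕ} {i₂ i₁ : (Fin (d + 1) → ℕ) × ℕ} (h₂ : i₂ ∈ LegIdx d L₂) (h₁ : i₁ ∈ LegIdx d L₁) :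
    comb L₁ i₂ i₁ ∈ LegIdx d (L₁ * L₂) := by
  rw [mem_LegIdx_iff] at h₂ h₁ ⊢
  exact ⟨fun j => mul_add_lt_mul (h₂.1 j) (h₁.1 j), mul_add_lt_mul h₂.2 h₁.2⟩

/-- [folklore] Splitting an admissible index for the product factor gives two admissible indices. -/
theorem split_mem {L₁ L₂ : ℕ} {i : (Fin (d + 1) → ℕ) × ℕ} (h : i ∈ LegIdx d (L₁ * L₂)) :
    (split L₁ i).1 ∈ LegIdx d L₂ ∧ (split L₁ i).2 ∈ LegIdx d L₁ := by
  rw [mem_LegIdx_iff] at h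
  have hL₁ : 0 < L₁ := Nat.pos_of_ne_zero fun h0 => by rw [h0, zero_mul] at h; exact Nat.not_lt_zero _ h.2
  refine ⟨mem_LegIdx_iff.2 ⟨fun j => Nat.div_lt_of_lt_mul (h.1 j), Nat.div_lt_of_lt_mul h.2⟩,
    mem_LegIdx_iff.2 ⟨fun j => Nat.mod_lt _ hL₁, Nat.mod_lt _ hL₁⟩⟩

/-- [folklore] `split ∘ comb = id` on admissible pairs. -/
theorem split_comb {L₁ : ℕ} {i₂ i₁ : (Fin (d + 1) → ℕ) × ℕ} (h₁ : i₁ ∈ LegIdx d L₁) :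
    split L₁ (comb (d := d) L₁ i₂ i₁) = (i₂, i₁) := by
  rw [mem_LegIdx_iff] at h₁
  have hL₁ : 0 < L₁ := lt_of_le_of_lt (Nat.zero_le _) h₁.2
  have hq : ∀ {a b : ℕ}, b < L₁ → (L₁ * a + b) / L₁ = a := fun {a b} hb => by
    rw [Nat.mul_add_div hL₁, Nat.div_eq_of_lt hb, add_zero]
  have hr : ∀ {a b : ℕ}, b < L₁ → (L₁ * a + b) % L₁ = b := fun {a b} hb => by
    rw [Nat.mul_add_mod, Nat.mod_eq_of_lt hb]
  simp only [split, comb]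
  refine Prod.ext (Prod.ext (funext fun j => ?_) ?_) (Prod.ext (funext fun j => ?_) ?_)
  · exact hq (h₁.1 j)
  · exact hq h₁.2
  · exact hr (h₁.1 j)
  · exact hr h₁.2

/-- [folklore] `comb ∘ split = id`. -/
theorem comb_split (L₁ : ℕ) (i : (Fin (d + 1) → ℕ) × ℕ) :
    comb L₁ (split (d := d) L₁ i).1 (split L₁ i).2 = i := by
  simp only [split, comb]
  exact Prod.ext (funext fun j => Nat.div_add_mod _ _) (Nat.div_add_mod _ _)

/-- [folklore] **RE-INDEXING OF THE BLOCK-CONTOUR INDEX SET ACROSS SCALES**: a sum over `LegIdx d (L₁·L₂)` is the double sum over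
`LegIdx d L₂` (outer, coarse) and `LegIdx d L₁` (inner, fine) of the combined indices. -/
theorem sum_LegIdx_mul {E : Type*} [AddCommMonoid E] (L₁ L₂ : ℕ) (f : (Fin (d + 1) → ℕ) × ℕ → E) :
    ∑ i ∈ LegIdx d (L₁ * L₂), f i = ∑ i₂ ∈ LegIdx d L₂, ∑ i₁ ∈ LegIdx d L₁, f (comb L₁ i₂ i₁) := by
  rw [← Finset.sum_product']
  symm
  refine Finset.sum_nbij' (fun p => comb L₁ p.1 p.2) (split L₁) ?_ ?_ ?_ ?_ ?_
  · intro p hp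
    rw [Finset.mem_product] at hp
    exact comb_mem hp.1 hp.2
  · intro i hi
    exact Finset.mem_product.2 (split_mem hi)
  · intro p hp
    rw [Finset.mem_product] at hp
    exact split_comb hp.2
  · intro i _
    exact comb_split L₁ i
  · intro p _
    rfl

/-- [folklore] **NESTED LEG POINTS**: the `L₁`-block-contour point (index `i₁`) of the `L₂`-block-contour point (index `i₂`) of `z` is
the `(L₁L₂)`-block-contour point of `z` with the combined index. -/
theorem legPt_legPt (L₁ L₂ : ℕ) (κ : Fin (d + 1)) (z : Fin (d + 1) → ℤ) (i₂ i₁ : (Fin (d + 1) → ℕ) × ℕ) :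
    legPt L₁ (Sum.inl κ : Fib d) (legPt L₂ (Sum.inl κ : Fib d) z i₂) i₁ =
      legPt (L₁ * L₂) (Sum.inl κ : Fib d) z (comb L₁ i₂ i₁) := by
  funext j
  simp only [legPt, comb, Pi.add_apply, Pi.smul_apply, smul_eq_mul, Nat.cast_mul, Nat.cast_add]
  split_ifs <;> ring

variable (M L₁ L₂ : ℕ)

/-- [folklore] The combined index PER LEG: trivial on a field leg, `comb` on a multiplier leg. -/
def combLeg (L₁ : ℕ) : Fib d → ((Fin (d + 1) → ℕ) × ℕ) → ((Fin (d + 1) → ℕ) × ℕ) → (Fin (d + 1) → ℕ) × ℕ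
  | Sum.inl _, _, _ => (fun _ => 0, 0)
  | Sum.inr _, i₂, i₁ => comb L₁ i₂ i₁

/-- [folklore] Re-indexing of the push index set across scales, per leg. -/
theorem sum_pushSet_mul {E : Type*} [AddCommMonoid E] (a : Fib d) (f : (Fin (d + 1) → ℕ) × ℕ → E) :
    ∑ i ∈ pushSet d (L₁ * L₂) a, f i = ∑ i₂ ∈ pushSet d L₂ a, ∑ i₁ ∈ pushSet d L₁ a, f (combLeg L₁ a i₂ i₁) := by
  rcases a with κ | μ
  · simp only [pushSet, combLeg, Finset.sum_singleton]
  · exact sum_LegIdx_mul L₁ L₂ f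

/-- [folklore] The outer indicator of two nested pushes is the indicator of the combined push. -/
theorem pushInd_mul_assoc (a : Fib d) (x : Fin (d + 1) → ℤ) :
    pushInd (M * L₁) L₂ a x = pushInd M (L₁ * L₂) a x := by
  rcases a with κ | μ
  · rfl
  · show (if Torus.proj (M * L₁ * L₂) x = 0 then (1 : ℝ) else 0) = if Torus.proj (M * (L₁ * L₂)) x = 0 then 1 else 0
    rw [Nat.mul_assoc]

/-- [folklore] At a pushed point the INNER indicator is `1` (pushed multiplier points lie on the intermediate coarse lattice). -/
theorem pushInd_pushPt (a : Fib d) (x : Fin (d + 1) → ℤ) (i₂ : (Fin (d + 1) → ℕ) × ℕ) :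
    pushInd M L₁ a (pushPt (M * L₁) L₂ a x i₂) = 1 := by
  rcases a with κ | μ
  · rfl
  · simp only [pushInd, pushPt, proj_zsmul, if_true]

/-- [folklore] **NESTED PUSH POINTS**: the inner push point of an outer push point is the push point of the combined push at the
combined index (`M, L₁ ≠ 0`). -/
theorem pushPt_pushPt [NeZero M] [NeZero L₁] (a : Fib d) (x : Fin (d + 1) → ℤ) (i₂ i₁ : (Fin (d + 1) → ℕ) × ℕ) :
    pushPt M L₁ a (pushPt (M * L₁) L₂ a x i₂) i₁ = pushPt M (L₁ * L₂) a x (combLeg L₁ a i₂ i₁) := by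
  haveI : NeZero (M * L₁) := ⟨mul_ne_zero (NeZero.ne M) (NeZero.ne L₁)⟩
  rcases a with κ | μ
  · rfl
  · simp only [pushPt, combLeg]
    rw [quo_zsmul, legPt_legPt, Nat.mul_assoc]

/-- [folklore] **NESTING OF PUSHES** («`Q′_{L₂} ∘ Q′_{L₁} = Q′_{L₁L₂}`», the `pushSum` avatar of
`ResolventComposition.contourSum_mul`): pushing the multiplier legs from the `M`-lattice to the `(M·L₁)`-lattice and then to the
`(M·L₁·L₂)`-lattice is the single push from the `M`-lattice to the `(M·(L₁L₂))`-lattice — for EVERY kernel and ALL legs. -/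
theorem pushSum_pushSum [NeZero M] [NeZero L₁] (K : ExpKernelCalculus.MKer (d + 1) (Fib d)) :
    pushSum (M * L₁) L₂ (pushSum M L₁ K) = pushSum M (L₁ * L₂) K := by
  funext x w a b
  show pushInd (M * L₁) L₂ a x * pushInd (M * L₁) L₂ b w *
      ∑ i₂ ∈ pushSet d L₂ a, ∑ i₂' ∈ pushSet d L₂ b,
        pushSum M L₁ K (pushPt (M * L₁) L₂ a x i₂) (pushPt (M * L₁) L₂ b w i₂') a b =
    pushInd M (L₁ * L₂) a x * pushInd M (L₁ * L₂) b w *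
      ∑ i ∈ pushSet d (L₁ * L₂) a, ∑ i' ∈ pushSet d (L₁ * L₂) b, K (pushPt M (L₁ * L₂) a x i) (pushPt M (L₁ * L₂) b w i') a b
  rw [pushInd_mul_assoc M L₁ L₂ a, pushInd_mul_assoc M L₁ L₂ b]
  congr 1
  simp only [pushSum, pushInd_pushPt, one_mul, pushPt_pushPt]
  rw [sum_pushSet_mul L₁ L₂ a]
  refine Finset.sum_congr rfl fun i₂ _ => ?_
  rw [Finset.sum_comm]
  refine Finset.sum_congr rfl fun i₁ _ => ?_
  rw [sum_pushSet_mul L₁ L₂ b]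

/-- [folklore] Nesting with the scale products supplied as equations (the form used under `Sc_succ`'s powers of `Lc`). -/
theorem pushSum_pushSum' {M L₁ L₂ P Q : ℕ} [NeZero M] [NeZero L₁] (hP : P = M * L₁) (hQ : Q = L₁ * L₂)
    (K : ExpKernelCalculus.MKer (d + 1) (Fib d)) : pushSum P L₂ (pushSum M L₁ K) = pushSum M Q K := by
  subst hP; subst hQ
  exact pushSum_pushSum M L₁ L₂ K

end Nest

/-! ## §3 The closed form of a push recursion and of an2's composite stencil family `Sc` -/

section Closed

variable {Lc : ℕ} [NeZero Lc]

/-- [folklore] **CLOSED FORM OF A PUSH RECURSION.**  If `T (n+1) = c • pushSum (Lc^{n+1}) Lc (T n) + I n` for all `n`, then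
`T (n+1) = c^{n+1} • pushSum Lc (Lc^{n+1}) (T 0) + I n + Σ_{m<n} c^{n−m} • pushSum (Lc^{m+2}) (Lc^{n−m}) (I m)`:
the base pushed through all `n+1` steps at once, the top increment unpushed, and every lower increment `I m` pushed from its own
lattice `Lc^{m+2}•ℤ^{d+1}` through the remaining `n − m` steps at once (nesting `pushSum_pushSum`). -/
theorem closed_form_of_rec (c : ℝ) (T I : ℕ → ExpKernelCalculus.MKer (d + 1) (Fib d))
    (hrec : ∀ n, T (n + 1) = c • pushSum (Lc ^ (n + 1)) Lc (T n) + I n) (n : ℕ) :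
    T (n + 1) = c ^ (n + 1) • pushSum Lc (Lc ^ (n + 1)) (T 0) + I n +
      ∑ m ∈ Finset.range n, c ^ (n - m) • pushSum (Lc ^ (m + 2)) (Lc ^ (n - m)) (I m) := by
  induction n with
  | zero =>
      simp only [hrec 0, Finset.range_zero, Finset.sum_empty, add_zero, zero_add, pow_one]
  | succ n ih =>
      rw [hrec (n + 1), ih, pushSum_add, pushSum_add, pushSum_smul, pushSum_finset_sum, smul_add, smul_add, smul_smul,
        Finset.smul_sum, Finset.sum_range_succ]
      -- the base term: one more blocking on top of `n+1` blockings at once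
      have hbase : pushSum (Lc ^ (n + 1 + 1)) Lc (pushSum Lc (Lc ^ (n + 1)) (T 0)) = pushSum Lc (Lc ^ (n + 1 + 1)) (T 0) :=
        pushSum_pushSum' (by rw [pow_succ']) (by rw [pow_succ]) (T 0)
      -- the lower increments: one more blocking on top of `n - m` blockings at once
      have hlow : ∀ m ∈ Finset.range n,
          c • pushSum (Lc ^ (n + 1 + 1)) Lc (c ^ (n - m) • pushSum (Lc ^ (m + 2)) (Lc ^ (n - m)) (I m)) =
            c ^ (n + 1 - m) • pushSum (Lc ^ (m + 2)) (Lc ^ (n + 1 - m)) (I m) := by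
        intro m hm
        have hmn : m < n := Finset.mem_range.1 hm
        have e1 : n + 1 - m = n - m + 1 := by omega
        have hP : Lc ^ (n + 1 + 1) = Lc ^ (m + 2) * Lc ^ (n - m) := by
          rw [← pow_add]; congr 1; omega
        rw [pushSum_smul, smul_smul, ← pow_succ', e1, pushSum_pushSum' hP (pow_succ Lc (n - m)) (I m)]
      -- the top increment of level `n` becomes the `m = n` term of the new sum
      have htop : c • pushSum (Lc ^ (n + 1 + 1)) Lc (I n) =
          c ^ (n + 1 - n) • pushSum (Lc ^ (n + 2)) (Lc ^ (n + 1 - n)) (I n) := by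
        rw [Nat.add_sub_cancel_left, pow_one, pow_one]
      rw [hbase, Finset.sum_congr rfl hlow, htop, ← pow_succ']
      abel

/-- [folklore] **THE CLOSED FORM OF an2's COMPOSITE STENCIL FAMILY** (`BalabanCompositeJets.Sc`, fine coordinates): at every fine bond
`(κ, u)`, the level-`(n+1)` composite first-order stencil is the first-step stencil `S₀ κ u` pushed through all `n+1` blockings
(weight `(Lc^{d+1})^{n+1}`), plus the top border/Lagrange increment, plus the `n` lower increments each pushed from its own level
through the remaining blockings at once (weights `(Lc^{d+1})^{n−m}` times the DEFINED unit weights `cVH·(Lc^{m+1})^{d+2}`,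
`cΛ·(Lc^{m+1})^{2d+4}` of `Sc_succ`) — `n+2` explicitly weighted pieces, channel by channel linear in `(cE, cVH, cΛ)`.  This is
S3-L3(d)'s «`Σ_{m<n} push_{m→n}[increment_m] + push_{0→n}[S₀]`» in position space. -/
theorem Sc_succ_closed (cE cVH cΛ : ℝ) (n : ℕ) (κ : Fin (d + 1)) (u : Fin (d + 1) → ℤ) :
    Sc d Lc cE cVH cΛ (n + 1) κ u =
      ((Lc : ℝ) ^ (d + 1)) ^ (n + 1) • pushSum Lc (Lc ^ (n + 1)) (S0 d Lc cE cVH cΛ κ u) +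
        ((cVH * ((Lc : ℝ) ^ (n + 1)) ^ (d + 2)) • borderInc d Lc (Lc ^ (n + 1)) κ u +
          (cΛ * ((Lc : ℝ) ^ (n + 1)) ^ (2 * d + 4)) • lagrInc d Lc (Lc ^ (n + 1)) (Lc ^ (n + 2)) κ u) +
        ∑ m ∈ Finset.range n, ((Lc : ℝ) ^ (d + 1)) ^ (n - m) •
          pushSum (Lc ^ (m + 2)) (Lc ^ (n - m))
            ((cVH * ((Lc : ℝ) ^ (m + 1)) ^ (d + 2)) • borderInc d Lc (Lc ^ (m + 1)) κ u +
              (cΛ * ((Lc : ℝ) ^ (m + 1)) ^ (2 * d + 4)) • lagrInc d Lc (Lc ^ (m + 1)) (Lc ^ (m + 2)) κ u) := by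
  have h := closed_form_of_rec (Lc := Lc) ((Lc : ℝ) ^ (d + 1)) (fun n => Sc d Lc cE cVH cΛ n κ u)
    (fun n => (cVH * ((Lc : ℝ) ^ (n + 1)) ^ (d + 2)) • borderInc d Lc (Lc ^ (n + 1)) κ u +
      (cΛ * ((Lc : ℝ) ^ (n + 1)) ^ (2 * d + 4)) • lagrInc d Lc (Lc ^ (n + 1)) (Lc ^ (n + 2)) κ u)
    (fun n => by simp only [Sc_succ, add_assoc]) n
  simpa only [Sc_zero] using h

/-- [folklore] The same closed form with the increments abbreviated: for ANY family `I` agreeing with the DEFINED increments of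
`Sc_succ`, the statement of `closed_form_of_rec` holds for `T n := Sc … n κ u` (convenient for term-by-term work: the D-S3-2 profile
is `m ↦ (Lc^{d+1})^{n−m} • pushSum (Lc^{m+2}) (Lc^{n−m}) (I m)`). -/
theorem Sc_succ_closed_of_inc (cE cVH cΛ : ℝ) (κ : Fin (d + 1)) (u : Fin (d + 1) → ℤ)
    (I : ℕ → ExpKernelCalculus.MKer (d + 1) (Fib d))
    (hI : ∀ m, I m = (cVH * ((Lc : ℝ) ^ (m + 1)) ^ (d + 2)) • borderInc d Lc (Lc ^ (m + 1)) κ u +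
      (cΛ * ((Lc : ℝ) ^ (m + 1)) ^ (2 * d + 4)) • lagrInc d Lc (Lc ^ (m + 1)) (Lc ^ (m + 2)) κ u) (n : ℕ) :
    Sc d Lc cE cVH cΛ (n + 1) κ u =
      ((Lc : ℝ) ^ (d + 1)) ^ (n + 1) • pushSum Lc (Lc ^ (n + 1)) (S0 d Lc cE cVH cΛ κ u) + I n +
        ∑ m ∈ Finset.range n, ((Lc : ℝ) ^ (d + 1)) ^ (n - m) • pushSum (Lc ^ (m + 2)) (Lc ^ (n - m)) (I m) := by
  have h := closed_form_of_rec (Lc := Lc) ((Lc : ℝ) ^ (d + 1)) (fun n => Sc d Lc cE cVH cΛ n κ u) I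
    (fun n => by simp only [Sc_succ, hI n, add_assoc]) n
  simpa only [Sc_zero] using h

end Closed

/-! ## §4 Dictionary: a pushed multiplier leg is a straight-contour block sum (`AffineAveraging.contourSum`) on the `M`-lattice -/

section Dictionary

variable (M L : ℕ)

/-- [folklore] Off the new coarse lattice a pushed multiplier leg vanishes (first leg). -/
theorem pushSum_inr_of_proj_ne {x : Fin (d + 1) → ℤ} (hx : Torus.proj (M * L) x ≠ 0)
    (K : ExpKernelCalculus.MKer (d + 1) (Fib d)) (w : Fin (d + 1) → ℤ) (μ : Fin (d + 1)) (b : Fib d) :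
    pushSum M L K x w (Sum.inr μ) b = 0 := by
  simp only [pushSum, pushInd, hx, if_false, zero_mul]

/-- [folklore] Off the new coarse lattice a pushed multiplier leg vanishes (second leg). -/
theorem pushSum_inr_of_proj_ne' {w : Fin (d + 1) → ℤ} (hw : Torus.proj (M * L) w ≠ 0)
    (K : ExpKernelCalculus.MKer (d + 1) (Fib d)) (x : Fin (d + 1) → ℤ) (a : Fib d) (ν : Fin (d + 1)) :
    pushSum M L K x w a (Sum.inr ν) = 0 := by
  simp only [pushSum, pushInd, hw, if_false, mul_zero, zero_mul]

variable [NeZero (M * L)]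

/-- [folklore] **PUSH = CONTOUR SUM (multiplier–field entry)** at a point `(M·L)•z` of the new coarse lattice: the pushed multiplier
leg reads the `L`-block straight-contour sum, on the `M`-lattice, of `y ↦ K (M•y) w (inr ·) (inl β)`. -/
theorem pushSum_inr_inl_coarse (K : ExpKernelCalculus.MKer (d + 1) (Fib d)) (z w : Fin (d + 1) → ℤ) (μ β : Fin (d + 1)) :
    pushSum M L K (((M * L : ℕ) : ℤ) • z) w (Sum.inr μ) (Sum.inl β) =
      contourSum L (fun ν y => K ((M : ℤ) • y) w (Sum.inr ν) (Sum.inl β)) μ z := by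
  rw [← sum_LegIdx_eq_contourSum]
  simp only [pushSum, pushInd, pushSet, pushPt, legSet, proj_zsmul, quo_zsmul, if_true, one_mul, Finset.sum_singleton]

/-- [folklore] **PUSH = CONTOUR SUM (field–multiplier entry)**, the transposed reading. -/
theorem pushSum_inl_inr_coarse (K : ExpKernelCalculus.MKer (d + 1) (Fib d)) (x z : Fin (d + 1) → ℤ) (α ν : Fin (d + 1)) :
    pushSum M L K x (((M * L : ℕ) : ℤ) • z) (Sum.inl α) (Sum.inr ν) =
      contourSum L (fun ν' y => K x ((M : ℤ) • y) (Sum.inl α) (Sum.inr ν')) ν z := by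
  rw [← sum_LegIdx_eq_contourSum]
  simp only [pushSum, pushInd, pushSet, pushPt, legSet, proj_zsmul, quo_zsmul, if_true, one_mul, Finset.sum_singleton]

/-- [folklore] **PUSH = DOUBLE CONTOUR SUM (multiplier–multiplier entry)** at a pair of points of the new coarse lattice. -/
theorem pushSum_inr_inr_coarse (K : ExpKernelCalculus.MKer (d + 1) (Fib d)) (z z' : Fin (d + 1) → ℤ) (μ ν : Fin (d + 1)) :
    pushSum M L K (((M * L : ℕ) : ℤ) • z) (((M * L : ℕ) : ℤ) • z') (Sum.inr μ) (Sum.inr ν) =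
      contourSum L (fun μ' y => contourSum L (fun ν' y' => K ((M : ℤ) • y) ((M : ℤ) • y') (Sum.inr μ') (Sum.inr ν')) ν z') μ z := by
  rw [← sum_LegIdx_eq_contourSum]
  simp only [← sum_LegIdx_eq_contourSum]
  simp only [pushSum, pushInd, pushSet, pushPt, legSet, proj_zsmul, quo_zsmul, if_true, one_mul]

end Dictionary

end Summit.QuantumFields.BalabanUV.Beta.GAN24.PushSumNest

end
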